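import Summits.CriticalPhenomena.PercolationContinuityZ3.Theorems.FK.InfiniteVolumeGibbs
import Summits.CriticalPhenomena.PercolationContinuityZ3.Theorems.FK.InfiniteVolumeCylinders
import HarnessLib

/-!
# FK-continuity transplant, FO-10 (domain-Markov toolkit, seat A): working forms of the free/wired sandwich
# for an infinite-volume random-cluster measure `FKGibbs d p q P`, and extremality of the box limits

Cell `fk-continuity` (bschramm), row FO-10a; support file for the FK-continuity transplant
(`--supports stmt-CriticalPhenomena-4575`); builds on p205010 (kernel theorem, internal audit signed; external
expert review pending).  Pure consequences of the cell's interface `FKGibbs` (`InfiniteVolumeGibbs.lean`, FO-06a: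
the free/wired SANDWICH form of Grimmett's Lemma (4.13) + Lemma (4.14)(b)) and of the box-limit predicate
`IsBoxLimit` (`InfiniteVolumeDefs.lean`, FO-06b).  No definitions, no named facts, no sorries.  These are the
statement-layer replacements, under `φ_{p,q}` with `q ≥ 1`, of the cone's disjoint-independence sites (cell
SCOPING.md §3.6, CONE-PERDECL.md §C families F1/F2: `bondPercolation_inter_of_disjoint`,
`prodBernoulli_real_inter_of_determinedBy`, `prodBernoulli_map_restrictConfig`): where the product measure gave
`P(history ∩ fresh event) = P(history) · P_p(fresh event)`, the sandwich gives two-sided bounds by the free and the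
wired measure of the fresh region.

## Contents

* `FKGibbs.wired_mul_le_of_isLowerSet` — the fourth corner of the sandwich (the interface file has the other
  three): a DECREASING `E_Λ`-event is, given local information outside, AT LEAST as likely as under the WIRED
  measure of `Λ`: `φ¹_{Λ,p,q}(D) · P(H) ≤ P(D ∩ H)`.
* ATOM-SUMMED sandwiches (the form explorations consume: the history is a finite disjoint union of atoms `H i`,
  each determined by finitely many pairs `T i`, the fresh region `Λ i` and the fresh event depend on the atom, and
  one has a UNIFORM bound on the region laws): `FKGibbs.mul_real_biUnion_le` (`c ≤ φ⁰_{Λ_i}(A_i)` for all `i` ⇒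
  `c · P(⋃ H_i) ≤ P(⋃ (A_i ∩ H_i))`), `FKGibbs.real_biUnion_le_mul` (`φ¹_{Λ_i}(A_i) ≤ C` ⇒
  `P(⋃ (A_i ∩ H_i)) ≤ C · P(⋃ H_i)`), and the decreasing twins `FKGibbs.real_biUnion_le_mul_of_isLowerSet`,
  `FKGibbs.mul_real_biUnion_le_of_isLowerSet` — Kozma–Nitzan's clause (4) of an exploration process (§4 p. 25,
  "`P(v ∈ G_{i+1} | G₁,…,G_i) ≥ …`") with the worst-case boundary condition compatible with the history, i.e. the
  tree's transfer `rcMeasureW_real_inter_ge_of_pattern_ge` in infinite volume.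
* `measureReal_le_pow_mul_of_succ_le` — the tower bound: `P(G_{k+1}) ≤ r · P(G_k)` for all `k` gives
  `P(G_k) ≤ r^k · P(G_0)` (sequential trials without independence).
* EXTREMALITY of the box limits within the sandwich class (Grimmett 2006, Thm. (4.19)(c) eq. (4.21) for limit
  measures, Thm. (4.34)(b) eq. (4.35) for DLR measures — here for every `P` with `FKGibbs d p q P`, a class containing
  both): `FKGibbs.isBoxLimit_real_le` (`φ⁰_{p,q}(A) ≤ P(A)`) and `FKGibbs.real_le_isBoxLimit` (`P(A) ≤ φ¹_{p,q}(A)`)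
  for increasing events determined by the edges of a finite region (resp. by a finite set of lattice edges:
  primed forms), the decreasing twins, and the uniqueness corollary `FKGibbs.eq_of_isBoxLimit` (Grimmett's
  (4.36), "⇐": if `φ⁰_{p,q} = φ¹_{p,q}` then it is the only measure in the class).

## References

* G. Grimmett, *The Random-Cluster Model*, Springer 2006: Lemma (4.13) p. 70, Lemma (4.14)(b) p. 71, Thm. (4.19)
  p. 76 with (4.21) and proof of (c) p. 77, Thm. (4.34)(b) (4.35)–(4.36) p. 81. [Grimmett2006]
* G. Kozma, S. Nitzan, arXiv:2401.12397 (2024), §4 p. 25 (exploration processes, clause (4)). [KozmaNitzan2024]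
-/

noncomputable section

open MeasureTheory Set Filter
open scoped Topology ENNReal

namespace Summit.CriticalPhenomena.PercolationContinuityZ3.Theorems.FK

open Literature.Probability.Percolation Literature.Probability.LatticeModels

variable {d : ℕ}

/-! ### Bookkeeping: regions of `ℤ^d`, boxes, increasing cylinders -/

section Bookkeeping

/-- `E_Λ ⊆ E_Δ` for `Λ ⊆ Δ`. [cite: Grimmett2006, §4.2 (E_Λ)] -/
theorem edgesIn_zdGraph_mono {Λ Δ : Finset (Site d)} (h : Λ ⊆ Δ) :
    edgesIn (zdGraph d) Λ ⊆ edgesIn (zdGraph d) Δ := by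
  intro e he
  rw [mem_edgesIn_iff] at he ⊢
  exact ⟨he.1, fun x hx => h (he.2 x hx)⟩

/-- A finite region lies in all large boxes `Λ_n = [-n,n]^d`. [cite: Grimmett2006, §4.3 (Λ_n ↑ ℤ^d)] -/
theorem eventually_subset_box (Λ : Finset (Site d)) : ∀ᶠ n in atTop, Λ ⊆ box d n :=
  Filter.eventually_atTop.2 ⟨Λ.sup siteRad, fun _ hn _ hx =>
    mem_box_iff_siteRad_le.2 ((Finset.le_sup hx).trans hn)⟩

/-- A finite set `F` of lattice edges lies in `E_{Λ_n}` for the box `Λ_n`, `n = sup pairRad F`, containing its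
endpoints. [cite: Grimmett2006, §4.3] -/
theorem subset_edgesIn_box_of_subset_edgeSet {F : Finset (Sym2 (Site d))}
    (hF : (↑F : Set (Sym2 (Site d))) ⊆ (zdGraph d).edgeSet) :
    (↑F : Set (Sym2 (Site d))) ⊆ ↑(edgesIn (zdGraph d) (box d (F.sup pairRad))) := by
  intro e he
  rw [Finset.mem_coe, mem_edgesIn_iff]
  exact ⟨hF he, fun z hz => mem_box_of_pairRad_le ((Finset.le_sup (f := pairRad) he).trans le_rfl) z hz⟩

/-- The increasing cylinder `{E₀ ⊆ ω}` is determined by `E₀`. [cite: Grimmett2006, §4.1] -/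
theorem determinedBy_setOf_subset (E₀ : Finset (Sym2 (Site d))) :
    DeterminedBy {ω : BondConfig (Site d) | (↑E₀ : Set (Sym2 (Site d))) ⊆ ω} ↑E₀ := by
  rw [determinedBy_iff]
  intro ω ω' h
  simp only [Set.mem_setOf_eq]
  constructor
  · intro hω e he
    have : e ∈ ω ∩ ↑E₀ := ⟨hω he, he⟩
    rw [h] at this
    exact this.1
  · intro hω' e he
    have : e ∈ ω' ∩ ↑E₀ := ⟨hω' he, he⟩
    rw [← h] at this
    exact this.1

/-- The increasing cylinder `{E₀ ⊆ ω}` is increasing. [folklore] -/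
theorem isUpperSet_setOf_finset_subset (E₀ : Finset (Sym2 (Site d))) :
    IsUpperSet {ω : BondConfig (Site d) | (↑E₀ : Set (Sym2 (Site d))) ⊆ ω} :=
  fun _ _ hle hω => Set.Subset.trans hω hle

end Bookkeeping

namespace FKGibbs

variable {p q : ℝ} {P : Measure (BondConfig (Site d))}

/-! ### The fourth corner of the sandwich: decreasing events from below -/

/-- Decreasing events, lower bound: given local information `H` outside `E_Λ`, a decreasing `E_Λ`-event is AT
LEAST as likely as under the WIRED measure of `Λ` (complement of the upper sandwich `le_wired_mul`).
[cite: Grimmett2006, Lemma (4.13) and Lemma (4.14)(b)] -/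
theorem wired_mul_le_of_isLowerSet (hP : FKGibbs d p q P) (hp : p ∈ Set.Icc (0 : ℝ) 1) (hq : 0 < q)
    (Λ : Finset (Site d)) {D H : Set (BondConfig (Site d))} (T : Finset (Sym2 (Site d))) (hD : IsLowerSet D)
    (hDΛ : DeterminedBy D ↑(edgesIn (zdGraph d) Λ))
    (hT : Disjoint (↑T : Set (Sym2 (Site d))) ↑(edgesIn (zdGraph d) Λ)) (hH : DeterminedBy H ↑T) :
    regionWiredReal d p q Λ D * P.real H ≤ P.real (D ∩ H) := by
  haveI := hP.isProbabilityMeasure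
  haveI := isProbabilityMeasure_rcMeasure (finsetGraph (zdGraph d) Λ) hp hq (wiredBoundary (zdGraph d) Λ)
  have hDm : MeasurableSet D := hDΛ.measurableSet_of_finset
  have hDc : IsUpperSet Dᶜ := hD.compl
  have hDcΛ : DeterminedBy Dᶜ ↑(edgesIn (zdGraph d) Λ) := by
    rw [determinedBy_iff] at hDΛ ⊢
    exact fun ω ω' h => not_congr (hDΛ ω ω' h)
  have h := hP.le_wired_mul Λ T hDc hDcΛ hT hH
  have h1 : P.real (Dᶜ ∩ H) = P.real H - P.real (D ∩ H) := by
    have h0 : P.real (H ∩ D) + P.real (H \ D) = P.real H := measureReal_inter_add_sdiff (s := H) hDm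
    rw [Set.sdiff_eq_compl_inter, Set.inter_comm H D] at h0
    linarith
  have h2 : regionWiredReal d p q Λ Dᶜ = 1 - regionWiredReal d p q Λ D := by
    rw [regionWiredReal, regionWiredReal, Set.preimage_compl, measureReal_compl]
    · simp
    · exact measurableSet_preimage (measurable_of_finite _) hDm
  rw [h1, h2] at h
  nlinarith [h, measureReal_nonneg (μ := P) (s := H)]

/-! ### Atom-summed sandwiches: histories as finite disjoint unions of local atoms -/

section Atoms

variable {ι : Type*}

/-- **Lower transfer over history atoms** (Kozma–Nitzan's clause (4) with the worst-case free boundary condition):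
if the history is the disjoint union of atoms `H i`, `i ∈ s`, each determined by a finite pair set `T i` disjoint
from the edges of its fresh region `Λ i`, the fresh events `A i` are increasing and determined by `E_{Λ i}`, and
`c ≤ φ⁰_{Λ_i,p,q}(A_i)` for every atom, then `c · P(⋃ H_i) ≤ P(⋃ (A_i ∩ H_i))`.
[cite: Grimmett2006, Lemma (4.13) and Lemma (4.14)(b)] -/
theorem mul_real_biUnion_le (hP : FKGibbs d p q P) (s : Finset ι) (Λ : ι → Finset (Site d))
    (T : ι → Finset (Sym2 (Site d))) (A H : ι → Set (BondConfig (Site d)))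
    (hA : ∀ i ∈ s, IsUpperSet (A i)) (hAΛ : ∀ i ∈ s, DeterminedBy (A i) ↑(edgesIn (zdGraph d) (Λ i)))
    (hT : ∀ i ∈ s, Disjoint (↑(T i) : Set (Sym2 (Site d))) ↑(edgesIn (zdGraph d) (Λ i)))
    (hH : ∀ i ∈ s, DeterminedBy (H i) ↑(T i)) (hdisj : (↑s : Set ι).PairwiseDisjoint H) {c : ℝ}
    (hc : ∀ i ∈ s, c ≤ regionFreeReal d p q (Λ i) (A i)) :
    c * P.real (⋃ i ∈ s, H i) ≤ P.real (⋃ i ∈ s, (A i ∩ H i)) := by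
  haveI := hP.isProbabilityMeasure
  have hHm : ∀ i ∈ s, MeasurableSet (H i) := fun i hi => (hH i hi).measurableSet_of_finset
  have hAHm : ∀ i ∈ s, MeasurableSet (A i ∩ H i) := fun i hi =>
    ((hAΛ i hi).measurableSet_of_finset).inter (hHm i hi)
  have hdisj' : (↑s : Set ι).PairwiseDisjoint fun i => A i ∩ H i :=
    hdisj.mono fun i => Set.inter_subset_right
  rw [measureReal_biUnion_finset hdisj hHm, measureReal_biUnion_finset hdisj' hAHm, Finset.mul_sum]
  refine Finset.sum_le_sum fun i hi => ?_
  exact (mul_le_mul_of_nonneg_right (hc i hi) measureReal_nonneg).trans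
    (hP.free_mul_le (Λ i) (T i) (hA i hi) (hAΛ i hi) (hT i hi) (hH i hi))

/-- **Upper transfer over history atoms** (worst case = wired): with atoms as in `mul_real_biUnion_le` and
`φ¹_{Λ_i,p,q}(A_i) ≤ C` for every atom, `P(⋃ (A_i ∩ H_i)) ≤ C · P(⋃ H_i)`.
[cite: Grimmett2006, Lemma (4.13) and Lemma (4.14)(b)] -/
theorem real_biUnion_le_mul (hP : FKGibbs d p q P) (s : Finset ι) (Λ : ι → Finset (Site d))
    (T : ι → Finset (Sym2 (Site d))) (A H : ι → Set (BondConfig (Site d)))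
    (hA : ∀ i ∈ s, IsUpperSet (A i)) (hAΛ : ∀ i ∈ s, DeterminedBy (A i) ↑(edgesIn (zdGraph d) (Λ i)))
    (hT : ∀ i ∈ s, Disjoint (↑(T i) : Set (Sym2 (Site d))) ↑(edgesIn (zdGraph d) (Λ i)))
    (hH : ∀ i ∈ s, DeterminedBy (H i) ↑(T i)) (hdisj : (↑s : Set ι).PairwiseDisjoint H) {C : ℝ}
    (hC : ∀ i ∈ s, regionWiredReal d p q (Λ i) (A i) ≤ C) :
    P.real (⋃ i ∈ s, (A i ∩ H i)) ≤ C * P.real (⋃ i ∈ s, H i) := by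
  haveI := hP.isProbabilityMeasure
  have hHm : ∀ i ∈ s, MeasurableSet (H i) := fun i hi => (hH i hi).measurableSet_of_finset
  have hAHm : ∀ i ∈ s, MeasurableSet (A i ∩ H i) := fun i hi =>
    ((hAΛ i hi).measurableSet_of_finset).inter (hHm i hi)
  have hdisj' : (↑s : Set ι).PairwiseDisjoint fun i => A i ∩ H i :=
    hdisj.mono fun i => Set.inter_subset_right
  rw [measureReal_biUnion_finset hdisj hHm, measureReal_biUnion_finset hdisj' hAHm, Finset.mul_sum]
  refine Finset.sum_le_sum fun i hi => ?_
  exact (hP.le_wired_mul (Λ i) (T i) (hA i hi) (hAΛ i hi) (hT i hi) (hH i hi)).trans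
    (mul_le_mul_of_nonneg_right (hC i hi) measureReal_nonneg)

/-- **Upper transfer over history atoms, decreasing events** (worst case = free): with atoms as above, fresh
DECREASING events `D i` determined by `E_{Λ i}` and `φ⁰_{Λ_i,p,q}(D_i) ≤ C` for every atom,
`P(⋃ (D_i ∩ H_i)) ≤ C · P(⋃ H_i)` — the failure step of a Kozma–Nitzan exploration ("this trial fails with
conditional probability at most `C` given the history"). [cite: Grimmett2006, Lemma (4.13) and Lemma (4.14)(b)] -/
theorem real_biUnion_le_mul_of_isLowerSet (hP : FKGibbs d p q P) (hp : p ∈ Set.Icc (0 : ℝ) 1) (hq : 0 < q)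
    (s : Finset ι) (Λ : ι → Finset (Site d)) (T : ι → Finset (Sym2 (Site d)))
    (D H : ι → Set (BondConfig (Site d)))
    (hD : ∀ i ∈ s, IsLowerSet (D i)) (hDΛ : ∀ i ∈ s, DeterminedBy (D i) ↑(edgesIn (zdGraph d) (Λ i)))
    (hT : ∀ i ∈ s, Disjoint (↑(T i) : Set (Sym2 (Site d))) ↑(edgesIn (zdGraph d) (Λ i)))
    (hH : ∀ i ∈ s, DeterminedBy (H i) ↑(T i)) (hdisj : (↑s : Set ι).PairwiseDisjoint H) {C : ℝ}
    (hC : ∀ i ∈ s, regionFreeReal d p q (Λ i) (D i) ≤ C) :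
    P.real (⋃ i ∈ s, (D i ∩ H i)) ≤ C * P.real (⋃ i ∈ s, H i) := by
  haveI := hP.isProbabilityMeasure
  have hHm : ∀ i ∈ s, MeasurableSet (H i) := fun i hi => (hH i hi).measurableSet_of_finset
  have hDm : ∀ i ∈ s, MeasurableSet (D i) := fun i hi => (hDΛ i hi).measurableSet_of_finset
  have hDHm : ∀ i ∈ s, MeasurableSet (D i ∩ H i) := fun i hi => (hDm i hi).inter (hHm i hi)
  have hdisj' : (↑s : Set ι).PairwiseDisjoint fun i => D i ∩ H i :=
    hdisj.mono fun i => Set.inter_subset_right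
  rw [measureReal_biUnion_finset hdisj hHm, measureReal_biUnion_finset hdisj' hDHm, Finset.mul_sum]
  refine Finset.sum_le_sum fun i hi => ?_
  exact (hP.le_free_mul_of_isLowerSet hp hq (Λ i) (T i) (hD i hi) (hDΛ i hi) (hDm i hi) (hT i hi)
    (hH i hi)).trans (mul_le_mul_of_nonneg_right (hC i hi) measureReal_nonneg)

/-- **Lower transfer over history atoms, decreasing events** (worst case = wired): with atoms as above, fresh
decreasing events `D i` and `c ≤ φ¹_{Λ_i,p,q}(D_i)` for every atom, `c · P(⋃ H_i) ≤ P(⋃ (D_i ∩ H_i))`.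
[cite: Grimmett2006, Lemma (4.13) and Lemma (4.14)(b)] -/
theorem mul_real_biUnion_le_of_isLowerSet (hP : FKGibbs d p q P) (hp : p ∈ Set.Icc (0 : ℝ) 1) (hq : 0 < q)
    (s : Finset ι) (Λ : ι → Finset (Site d)) (T : ι → Finset (Sym2 (Site d)))
    (D H : ι → Set (BondConfig (Site d)))
    (hD : ∀ i ∈ s, IsLowerSet (D i)) (hDΛ : ∀ i ∈ s, DeterminedBy (D i) ↑(edgesIn (zdGraph d) (Λ i)))
    (hT : ∀ i ∈ s, Disjoint (↑(T i) : Set (Sym2 (Site d))) ↑(edgesIn (zdGraph d) (Λ i)))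
    (hH : ∀ i ∈ s, DeterminedBy (H i) ↑(T i)) (hdisj : (↑s : Set ι).PairwiseDisjoint H) {c : ℝ}
    (hc : ∀ i ∈ s, c ≤ regionWiredReal d p q (Λ i) (D i)) :
    c * P.real (⋃ i ∈ s, H i) ≤ P.real (⋃ i ∈ s, (D i ∩ H i)) := by
  haveI := hP.isProbabilityMeasure
  have hHm : ∀ i ∈ s, MeasurableSet (H i) := fun i hi => (hH i hi).measurableSet_of_finset
  have hDHm : ∀ i ∈ s, MeasurableSet (D i ∩ H i) := fun i hi =>
    ((hDΛ i hi).measurableSet_of_finset).inter (hHm i hi)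
  have hdisj' : (↑s : Set ι).PairwiseDisjoint fun i => D i ∩ H i :=
    hdisj.mono fun i => Set.inter_subset_right
  rw [measureReal_biUnion_finset hdisj hHm, measureReal_biUnion_finset hdisj' hDHm, Finset.mul_sum]
  refine Finset.sum_le_sum fun i hi => ?_
  exact (mul_le_mul_of_nonneg_right (hc i hi) measureReal_nonneg).trans
    (hP.wired_mul_le_of_isLowerSet hp hq (Λ i) (T i) (hD i hi) (hDΛ i hi) (hT i hi) (hH i hi))

end Atoms

end FKGibbs

/-! ### Sequential trials: the tower bound -/

/-- **Geometric decay from a one-step conditional bound** (the tower property, no independence): if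
`P(G_{k+1}) ≤ r · P(G_k)` for every `k` (each new trial fails with conditional probability at most `r` given
the accumulated failure history `G_k`, e.g. by `FKGibbs.real_biUnion_le_mul_of_isLowerSet`), then
`P(G_k) ≤ r^k · P(G_0)`. [cite: KozmaNitzan2024, §4 p. 25 (exploration processes)] -/
theorem measureReal_le_pow_mul_of_succ_le {Ω : Type*} [MeasurableSpace Ω] (P : Measure Ω) (G : ℕ → Set Ω)
    {r : ℝ} (hr : 0 ≤ r) (h : ∀ k, P.real (G (k + 1)) ≤ r * P.real (G k)) (k : ℕ) :
    P.real (G k) ≤ r ^ k * P.real (G 0) := by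
  induction k with
  | zero => simp
  | succ k ih =>
    calc P.real (G (k + 1)) ≤ r * P.real (G k) := h k
      _ ≤ r * (r ^ k * P.real (G 0)) := mul_le_mul_of_nonneg_left ih hr
      _ = r ^ (k + 1) * P.real (G 0) := by rw [pow_succ]; ring

/-! ### Extremality of the box limits within the sandwich class (Grimmett 2006, (4.21), (4.35)) -/

namespace FKGibbs

variable {p q : ℝ} {P P₀ P₁ : Measure (BondConfig (Site d))}

/-- **`φ⁰_{p,q} ≤ P` on increasing local events** (Grimmett 2006, Thm. (4.19)(c) eq. (4.21) / Thm. (4.34)(b)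
eq. (4.35), lower half, for the sandwich class): if `P₀` is the free box limit and `P` satisfies the free/wired
sandwich, then `P₀(A) ≤ P(A)` for every increasing event `A` determined by the edges of a finite region.  Proof:
`φ⁰_{Λ_n}(A) ≤ P(A)` for all large `n` (lower sandwich with `H = univ` in the box `Λ_n ⊇ Λ`), and
`φ⁰_{Λ_n}(A) → P₀(A)`. [cite: Grimmett2006, Thm. (4.19)(c) eq. (4.21)] -/
theorem isBoxLimit_real_le (hP : FKGibbs d p q P) (hP₀ : IsBoxLimit d false p q P₀)
    {A : Set (BondConfig (Site d))} {Λ : Finset (Site d)} (hA : IsUpperSet A)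
    (hAΛ : DeterminedBy A ↑(edgesIn (zdGraph d) Λ)) : P₀.real A ≤ P.real A := by
  haveI := hP₀.isProbabilityMeasure
  have hAm : MeasurableSet A := hAΛ.measurableSet_of_finset
  have hev : ∀ᶠ n in atTop, (rcBoxLaw d false p q n).real A ≤ P.real A := by
    filter_upwards [eventually_subset_box Λ] with n hn
    rw [← regionFreeReal_box p q n hAm]
    exact hP.regionFreeReal_le (box d n) hA (hAΛ.mono (Finset.coe_subset.2 (edgesIn_zdGraph_mono hn)))
  have hlim : Tendsto (fun n => (rcBoxLaw d false p q n).real A) atTop (𝓝 (P₀.real A)) := by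
    simp only [measureReal_def]
    exact (ENNReal.tendsto_toReal (measure_ne_top P₀ A)).comp (hP₀.tendsto_of_isLocalEvent A ⟨_, hAΛ⟩)
  exact le_of_tendsto hlim hev

/-- **`P ≤ φ¹_{p,q}` on increasing local events** (Grimmett 2006, (4.21)/(4.35), upper half, for the sandwich
class): if `P₁` is the wired box limit and `P` satisfies the free/wired sandwich, then `P(A) ≤ P₁(A)` for every
increasing event `A` determined by the edges of a finite region. [cite: Grimmett2006, Thm. (4.19)(c) eq. (4.21)] -/
theorem real_le_isBoxLimit (hP : FKGibbs d p q P) (hP₁ : IsBoxLimit d true p q P₁)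
    {A : Set (BondConfig (Site d))} {Λ : Finset (Site d)} (hA : IsUpperSet A)
    (hAΛ : DeterminedBy A ↑(edgesIn (zdGraph d) Λ)) : P.real A ≤ P₁.real A := by
  haveI := hP₁.isProbabilityMeasure
  have hAm : MeasurableSet A := hAΛ.measurableSet_of_finset
  have hev : ∀ᶠ n in atTop, P.real A ≤ (rcBoxLaw d true p q n).real A := by
    filter_upwards [eventually_subset_box Λ] with n hn
    rw [← regionWiredReal_box p q n hAm]
    exact hP.le_regionWiredReal (box d n) hA (hAΛ.mono (Finset.coe_subset.2 (edgesIn_zdGraph_mono hn)))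
  have hlim : Tendsto (fun n => (rcBoxLaw d true p q n).real A) atTop (𝓝 (P₁.real A)) := by
    simp only [measureReal_def]
    exact (ENNReal.tendsto_toReal (measure_ne_top P₁ A)).comp (hP₁.tendsto_of_isLocalEvent A ⟨_, hAΛ⟩)
  exact ge_of_tendsto hlim hev

/-- `φ⁰_{p,q}(A) ≤ P(A)` for an increasing event determined by a finite set `F` of LATTICE edges (the region is
the box containing the endpoints of `F`). [cite: Grimmett2006, Thm. (4.19)(c) eq. (4.21)] -/
theorem isBoxLimit_real_le' (hP : FKGibbs d p q P) (hP₀ : IsBoxLimit d false p q P₀)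
    {A : Set (BondConfig (Site d))} {F : Finset (Sym2 (Site d))} (hA : IsUpperSet A)
    (hAF : DeterminedBy A ↑F) (hF : (↑F : Set (Sym2 (Site d))) ⊆ (zdGraph d).edgeSet) : P₀.real A ≤ P.real A :=
  hP.isBoxLimit_real_le hP₀ hA (hAF.mono (subset_edgesIn_box_of_subset_edgeSet hF))

/-- `P(A) ≤ φ¹_{p,q}(A)` for an increasing event determined by a finite set `F` of lattice edges.
[cite: Grimmett2006, Thm. (4.19)(c) eq. (4.21)] -/
theorem real_le_isBoxLimit' (hP : FKGibbs d p q P) (hP₁ : IsBoxLimit d true p q P₁)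
    {A : Set (BondConfig (Site d))} {F : Finset (Sym2 (Site d))} (hA : IsUpperSet A)
    (hAF : DeterminedBy A ↑F) (hF : (↑F : Set (Sym2 (Site d))) ⊆ (zdGraph d).edgeSet) : P.real A ≤ P₁.real A :=
  hP.real_le_isBoxLimit hP₁ hA (hAF.mono (subset_edgesIn_box_of_subset_edgeSet hF))

/-- Decreasing local events: `P(D) ≤ φ⁰_{p,q}(D)` (complement of `isBoxLimit_real_le`).
[cite: Grimmett2006, Thm. (4.19)(c) eq. (4.21)] -/
theorem real_le_isBoxLimit_of_isLowerSet (hP : FKGibbs d p q P) (hP₀ : IsBoxLimit d false p q P₀)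
    {D : Set (BondConfig (Site d))} {Λ : Finset (Site d)} (hD : IsLowerSet D)
    (hDΛ : DeterminedBy D ↑(edgesIn (zdGraph d) Λ)) : P.real D ≤ P₀.real D := by
  haveI := hP.isProbabilityMeasure
  haveI := hP₀.isProbabilityMeasure
  have hDm : MeasurableSet D := hDΛ.measurableSet_of_finset
  have hDcΛ : DeterminedBy Dᶜ ↑(edgesIn (zdGraph d) Λ) := by
    have h := hDΛ
    rw [determinedBy_iff] at h ⊢
    exact fun ω ω' hω => not_congr (h ω ω' hω)
  have h := hP.isBoxLimit_real_le hP₀ hD.compl hDcΛ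
  rw [measureReal_compl hDm, measureReal_compl hDm, probReal_univ, probReal_univ] at h
  linarith

/-- Decreasing local events: `φ¹_{p,q}(D) ≤ P(D)` (complement of `real_le_isBoxLimit`).
[cite: Grimmett2006, Thm. (4.19)(c) eq. (4.21)] -/
theorem isBoxLimit_real_le_of_isLowerSet (hP : FKGibbs d p q P) (hP₁ : IsBoxLimit d true p q P₁)
    {D : Set (BondConfig (Site d))} {Λ : Finset (Site d)} (hD : IsLowerSet D)
    (hDΛ : DeterminedBy D ↑(edgesIn (zdGraph d) Λ)) : P₁.real D ≤ P.real D := by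
  haveI := hP.isProbabilityMeasure
  haveI := hP₁.isProbabilityMeasure
  have hDm : MeasurableSet D := hDΛ.measurableSet_of_finset
  have hDcΛ : DeterminedBy Dᶜ ↑(edgesIn (zdGraph d) Λ) := by
    have h := hDΛ
    rw [determinedBy_iff] at h ⊢
    exact fun ω ω' hω => not_congr (h ω ω' hω)
  have h := hP.real_le_isBoxLimit hP₁ hD.compl hDcΛ
  rw [measureReal_compl hDm, measureReal_compl hDm, probReal_univ, probReal_univ] at h
  linarith

/-- **Squeeze**: where the free and the wired box limits agree on an increasing local event, every measure of the
sandwich class takes the same value. [cite: Grimmett2006, Thm. (4.34) eq. (4.35)–(4.36)] -/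
theorem real_eq_of_isBoxLimit_real_eq (hP : FKGibbs d p q P) (hP₀ : IsBoxLimit d false p q P₀)
    (hP₁ : IsBoxLimit d true p q P₁) {A : Set (BondConfig (Site d))} {Λ : Finset (Site d)} (hA : IsUpperSet A)
    (hAΛ : DeterminedBy A ↑(edgesIn (zdGraph d) Λ)) (h01 : P₀.real A = P₁.real A) : P.real A = P₀.real A :=
  le_antisymm (h01 ▸ hP.real_le_isBoxLimit hP₁ hA hAΛ) (hP.isBoxLimit_real_le hP₀ hA hAΛ)

/-- **Uniqueness within the sandwich class** (Grimmett 2006, (4.36), "⇐"): if the free and the wired box limits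
coincide, `φ⁰_{p,q} = φ¹_{p,q}`, then every probability measure satisfying the free/wired sandwich — in particular
(FO-06a `IsBoxLimit.fkGibbs`) every box limit, and every DLR measure in the sense of (4.30) — equals it.  The
hypothesis `h₀E` (the box limit is carried by lattice configurations) is FO-06b's `IsBoxLimit.ae_subset_edgeSet`.
Proof: the increasing cylinders `{E₀ ⊆ ω}` determine a probability measure (`ext_of_setOf_subset`); for `E₀`
made of lattice edges squeeze, otherwise both sides vanish. [cite: Grimmett2006, Thm. (4.34) eq. (4.35)–(4.36)] -/
theorem eq_of_isBoxLimit (hP : FKGibbs d p q P) (hP₀ : IsBoxLimit d false p q P₀)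
    (hP₁ : IsBoxLimit d true p q P₁) (h01 : P₀ = P₁) (h₀E : ∀ᵐ ω ∂P₀, ω ⊆ (zdGraph d).edgeSet) : P = P₀ := by
  haveI := hP.isProbabilityMeasure
  haveI := hP₀.isProbabilityMeasure
  refine ext_of_setOf_subset fun E₀ => ?_
  by_cases hE : (↑E₀ : Set (Sym2 (Site d))) ⊆ (zdGraph d).edgeSet
  · -- increasing cylinder of lattice edges: squeeze between `P₀` and `P₁ = P₀`
    have hdet := (determinedBy_setOf_subset E₀).mono (subset_edgesIn_box_of_subset_edgeSet hE)
    have h := hP.real_eq_of_isBoxLimit_real_eq hP₀ hP₁ (isUpperSet_setOf_finset_subset E₀) hdet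
      (by rw [h01])
    exact (ENNReal.toReal_eq_toReal_iff' (measure_ne_top P _) (measure_ne_top P₀ _)).1 h
  · -- a non-lattice pair in `E₀`: the cylinder is null for both measures
    obtain ⟨e, heE₀, he⟩ := Set.not_subset.1 hE
    have hsub : {ω : BondConfig (Site d) | (↑E₀ : Set (Sym2 (Site d))) ⊆ ω} ⊆ {ω | ¬ ω ⊆ (zdGraph d).edgeSet} :=
      fun ω hω hωE => he (hωE (hω heE₀))
    have hP0 : P {ω : BondConfig (Site d) | (↑E₀ : Set (Sym2 (Site d))) ⊆ ω} = 0 :=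
      measure_mono_null hsub (by simpa [ae_iff] using hP.ae_subset_edgeSet)
    have hP₀0 : P₀ {ω : BondConfig (Site d) | (↑E₀ : Set (Sym2 (Site d))) ⊆ ω} = 0 :=
      measure_mono_null hsub (by simpa [ae_iff] using h₀E)
    rw [hP0, hP₀0]

end FKGibbs

end Summit.CriticalPhenomena.PercolationContinuityZ3.Theorems.FK

end
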